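import Summits.QuantumFields.YangMills.Theses.FradkinShenkerFlow
import Summits.QuantumFields.YangMills.Theorems.SusceptibilityToPoincare.Negative.Bottleneck
import Summits.QuantumFields.YangMills.Theorems.SusceptibilityToPoincare.Negative.TwistSectorSimplyConnected

/-!
# `SusceptibilityToPoincare` — negative side: the scope sentinel of line `rg-variance-cascade` modulo the twist inputs

Negative-side support for crux `stmt-QuantumFields-9441`
(`Summit.QuantumFields.YangMills.Theses.FradkinShenkerFlow.SusceptibilityToPoincare`, FS ⇒ UP) and for the registered
skeleton `Cruxes/SusceptibilityToPoincare/Lines/rg_variance_cascade.lean` (lead a1-0, v2.3).  That line concludes the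
decl AS TYPED from four C″-scoped analytic stubs (B, C, D) and ONE scope sentinel T = `stub_typedDeclResidual`:
"for every compact simple `G` and `r`, if (whenever `G` is simply connected) FS ⇒ UP holds above some threshold
`β⋆(G, r)`, then FS ⇒ UP holds for all `β ≥ 0`".  The line card marks T NOT TO BE STAFFED; this file records,
kernel-checked and in the tree, WHY: T is false modulo the standing twist-sector inputs on both sides of the `π₁` cut.

* `typedDeclResidual_false_of_twistInputs_centreless` — for a CENTRELESS compact simple `G` the hypothesis of T is
  vacuous, so T restricts to "FS ⇒ UP at every `β ≥ 0`"; a gauge-theory bottleneck (events of mass in `[δ, 1−δ]` with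
  vanishing heat-bath boundary flux along `S → ∞`, at a point where FS holds) kills every uniform heat-bath Poincaré
  constant (`Negative.not_uniformHeatBathPoincare_of_bottleneck`, p74081).  The hypothesis H is the 't Hooft
  twist-sector input for `SO(3)₄` written out VERBATIM (it is the body of the registered open Literature statement of
  the twist-sector inputs, p76562, deliberately neither imported nor named: route-choice rchoice-…-8bac143f).
* `typedDeclResidual_false_of_twistInputsSU2` — for `G = SU(2)` with the Bhanot–Creutz phase-II witness hW of
  `Negative/TwistSectorSimplyConnected.lean` (p77766; restated verbatim) and the weak-coupling simply-connected core
  C″ supplied at `SU(2)` (believed TRUE — it is the open core of the crux), T yields FS ⇒ UP at the witness `(r, β)`,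
  where the gauge-invariant twist sectors form a bottleneck (`Negative.not_invariantHeatBathPoincare_of_invariantBottleneck`).

Both are conditional on open confinement-grade inputs (NEGATIVE LEMMA HOLDS rule: T is not refuted in the ledger sense),
exactly like the crux itself; T is the typed decl minus its open core.  T is restated verbatim from the registered
skeleton (the `:=`-free ascription spelling `(wilsonMeasure r.ρ β : Measure (GaugeConfig 4 (2 * S + 1) G))` of
`wilsonMeasure (d := 4) (L := 2 * S + 1) r.ρ β`, the same term).

Sources: G. 't Hooft, Nucl. Phys. B 153 (1979) 141 (twist sectors); G. Bhanot, M. Creutz, Phys. Rev. D 24 (1981) 3212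
(mixed fundamental–adjoint SU(2) action); P. de Forcrand, O. Jahn, Nucl. Phys. B 651 (2003) 125 (SO(3) twist sectors on
the lattice); the bottleneck lemma is the elementary `μ(A)(1 − μ(A)) ≤ C · ℰ_hb(1_A)`.
-/

noncomputable section

open MeasureTheory ProbabilityTheory Filter Topology
open Literature.MathematicalPhysics.QuantumFieldTheory

namespace Summit.QuantumFields.YangMills.Theorems.SusceptibilityToPoincare.Negative

/-- **The scope sentinel T of line `rg-variance-cascade` is false modulo the 't Hooft twist-sector inputs H**
(centreless half).  H (verbatim body of the registered open twist-sector statement): some centreless compact simple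
`G`, faithful unitary `r`, `β ≥ 0` with FS(r, β), and gauge-invariant measurable events `A_S` of `μ_{β,S}`-mass in
`[δ, 1 − δ]` whose heat-bath boundary flux tends to `0` as `S → ∞`.  Then T fails: its hypothesis is vacuous at this `G`
(`¬ SimplyConnectedSpace G`), its conclusion is a uniform heat-bath Poincaré inequality at `(r, β)`, and the bottleneck
lemma `Negative.not_uniformHeatBathPoincare_of_bottleneck` refutes the latter. [folklore] -/
theorem typedDeclResidual_false_of_twistInputs_centreless :
    (∃ (G : Type) (_ : Group G) (_ : TopologicalSpace G) (_ : IsTopologicalGroup G) (_ : CompactSpace G)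
      (_ : MeasurableSpace G) (_ : BorelSpace G),
      IsCompactSimpleLieGroup G ∧ ¬ SimplyConnectedSpace G ∧
      ∃ (r : LatticeRep G) (β : ℝ), 0 ≤ β ∧
      (∀ A B : YMSpecies G, ∃ χ : ℝ, ∀ S : ℕ, ∑ x ∈ Literature.Probability.LatticeModels.box 4 S,
        |covariance (fun U => A.F (Literature.MathematicalPhysics.QuantumLattice.torusLift (2 * S + 1) U))
          (fun U => B.F (Literature.MathematicalPhysics.QuantumLattice.configShift (-x)
              (Literature.MathematicalPhysics.QuantumLattice.torusLift (2 * S + 1) U)))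
          (wilsonMeasure r.ρ β : Measure (GaugeConfig 4 (2 * S + 1) G))| ≤ χ) ∧
      ∃ δ : ℝ, 0 < δ ∧ ∃ A : ∀ S : ℕ, Set (GaugeConfig 4 (2 * S + 1) G),
        (∀ S, MeasurableSet (A S)) ∧
        (∀ S, IsGaugeInvariant ((A S).indicator (1 : GaugeConfig 4 (2 * S + 1) G → ℝ))) ∧
        (∀ S, δ ≤ (wilsonMeasure r.ρ β : Measure (GaugeConfig 4 (2 * S + 1) G)).real (A S) ∧
          (wilsonMeasure r.ρ β : Measure (GaugeConfig 4 (2 * S + 1) G)).real (A S) ≤ 1 - δ) ∧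
        Tendsto (fun S : ℕ => ∑ ℓ : Edge 4 (2 * S + 1), ∫ U, ∫ g,
            ((A S).indicator (1 : GaugeConfig 4 (2 * S + 1) G → ℝ) U -
              (A S).indicator 1 (Function.update U ℓ g)) ^ 2
          ∂((haarProbability G).tilted (fun g' => -β * wilsonAction r.ρ (Function.update U ℓ g')))
          ∂(wilsonMeasure r.ρ β : Measure (GaugeConfig 4 (2 * S + 1) G))) atTop (𝓝 0)) →
    ¬ (
      ∀ (G : Type) [Group G] [TopologicalSpace G] [IsTopologicalGroup G] [CompactSpace G]
        [MeasurableSpace G] [BorelSpace G], IsCompactSimpleLieGroup G → ∀ (r : LatticeRep G),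
        (SimplyConnectedSpace G → ∃ β₁ : ℝ, ∀ β : ℝ, β₁ ≤ β →
        (∀ A B : YMSpecies G, ∃ χ : ℝ, ∀ S : ℕ, ∑ x ∈ Literature.Probability.LatticeModels.box 4 S,
          |covariance (fun U => A.F (Literature.MathematicalPhysics.QuantumLattice.torusLift (2 * S + 1) U))
            (fun U => B.F (Literature.MathematicalPhysics.QuantumLattice.configShift (-x)
            (Literature.MathematicalPhysics.QuantumLattice.torusLift (2 * S + 1) U)))
            (wilsonMeasure r.ρ β : Measure (GaugeConfig 4 (2 * S + 1) G))| ≤ χ) →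
        (∃ C : ℝ, ∀ S : ℕ, ∀ F : GaugeConfig 4 (2 * S + 1) G → ℝ, Measurable F → (∃ M : ℝ, ∀ U, |F U| ≤ M) →
          variance F (wilsonMeasure r.ρ β : Measure (GaugeConfig 4 (2 * S + 1) G)) ≤
            C * ∑ ℓ : Edge 4 (2 * S + 1), ∫ U, ∫ g, (F U - F (Function.update U ℓ g)) ^ 2
              ∂((haarProbability G).tilted (fun g' => -β * wilsonAction r.ρ (Function.update U ℓ g')))
              ∂(wilsonMeasure r.ρ β : Measure (GaugeConfig 4 (2 * S + 1) G)))) →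
        ∀ β : ℝ, 0 ≤ β →
        (∀ A B : YMSpecies G, ∃ χ : ℝ, ∀ S : ℕ, ∑ x ∈ Literature.Probability.LatticeModels.box 4 S,
          |covariance (fun U => A.F (Literature.MathematicalPhysics.QuantumLattice.torusLift (2 * S + 1) U))
            (fun U => B.F (Literature.MathematicalPhysics.QuantumLattice.configShift (-x)
            (Literature.MathematicalPhysics.QuantumLattice.torusLift (2 * S + 1) U)))
            (wilsonMeasure r.ρ β : Measure (GaugeConfig 4 (2 * S + 1) G))| ≤ χ) →
        (∃ C : ℝ, ∀ S : ℕ, ∀ F : GaugeConfig 4 (2 * S + 1) G → ℝ, Measurable F → (∃ M : ℝ, ∀ U, |F U| ≤ M) →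
          variance F (wilsonMeasure r.ρ β : Measure (GaugeConfig 4 (2 * S + 1) G)) ≤
            C * ∑ ℓ : Edge 4 (2 * S + 1), ∫ U, ∫ g, (F U - F (Function.update U ℓ g)) ^ 2
              ∂((haarProbability G).tilted (fun g' => -β * wilsonAction r.ρ (Function.update U ℓ g')))
              ∂(wilsonMeasure r.ρ β : Measure (GaugeConfig 4 (2 * S + 1) G)))) := by
  intro h hT
  obtain ⟨G, _, _, _, _, _, _, hG, hnsc, r, β, hβ, hFS, δ, hδ, A, hmeas, -, hmass, hflux⟩ := h
  exact not_uniformHeatBathPoincare_of_bottleneck r β hδ A hmeas hmass hflux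
    (hT G hG r (fun hsc => absurd hsc hnsc) β hβ hFS)

/-- **The scope sentinel T of line `rg-variance-cascade` is false modulo (the Bhanot–Creutz SU(2) twist inputs hW ∧ the
weak-coupling simply-connected core C″ at SU(2))** (simply-connected half).  hW is restated verbatim from
`Negative/TwistSectorSimplyConnected.lean` (p77766): a faithful unitary `r` of `SU(2)` (intended `ρ_{1/2} ⊕ ρ₁^{⊕k}`),
`β ≥ 0` in phase II of the Bhanot–Creutz plane with FS(r, β), and gauge-invariant events of mass in `[δ, 1−δ]` with
vanishing heat-bath flux.  With C″ supplied at `SU(2)` (`hcore`: FS ⇒ UP above some `β₁(r)` for every `r`), T's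
hypothesis is discharged and T yields a uniform heat-bath Poincaré inequality at the witness `(r, β)`, refuted on the
gauge-invariant observables by `Negative.not_invariantHeatBathPoincare_of_invariantBottleneck`.  No `SimplyConnectedSpace
SU(2)` input is needed. [folklore] -/
theorem typedDeclResidual_false_of_twistInputsSU2 :
    (∃ (r : LatticeRep (Matrix.specialUnitaryGroup (Fin 2) ℂ)) (β : ℝ), 0 ≤ β ∧
      (∀ A B : YMSpecies (Matrix.specialUnitaryGroup (Fin 2) ℂ), ∃ χ : ℝ, ∀ S : ℕ,
        ∑ x ∈ Literature.Probability.LatticeModels.box 4 S,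
        |covariance (fun U => A.F (Literature.MathematicalPhysics.QuantumLattice.torusLift (2 * S + 1) U))
          (fun U => B.F (Literature.MathematicalPhysics.QuantumLattice.configShift (-x)
          (Literature.MathematicalPhysics.QuantumLattice.torusLift (2 * S + 1) U)))
          (wilsonMeasure r.ρ β : Measure (GaugeConfig 4 (2 * S + 1) (Matrix.specialUnitaryGroup (Fin 2) ℂ)))| ≤ χ) ∧
      ∃ δ : ℝ, 0 < δ ∧ ∃ A : (∀ S : ℕ, Set (GaugeConfig 4 (2 * S + 1) (Matrix.specialUnitaryGroup (Fin 2) ℂ))),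
        (∀ S, MeasurableSet (A S)) ∧
        (∀ S, IsGaugeInvariant ((A S).indicator
          (1 : GaugeConfig 4 (2 * S + 1) (Matrix.specialUnitaryGroup (Fin 2) ℂ) → ℝ))) ∧
        (∀ S, δ ≤ (wilsonMeasure r.ρ β : Measure (GaugeConfig 4 (2 * S + 1) (Matrix.specialUnitaryGroup (Fin 2) ℂ))).real (A S) ∧
          (wilsonMeasure r.ρ β : Measure (GaugeConfig 4 (2 * S + 1) (Matrix.specialUnitaryGroup (Fin 2) ℂ))).real (A S) ≤ 1 - δ) ∧
        Tendsto (fun S : ℕ => ∑ ℓ : Edge 4 (2 * S + 1), ∫ U, ∫ g,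
            ((A S).indicator (1 : GaugeConfig 4 (2 * S + 1) (Matrix.specialUnitaryGroup (Fin 2) ℂ) → ℝ) U -
              (A S).indicator 1 (Function.update U ℓ g)) ^ 2
          ∂((haarProbability (Matrix.specialUnitaryGroup (Fin 2) ℂ)).tilted
              (fun g' => -β * wilsonAction r.ρ (Function.update U ℓ g')))
          ∂(wilsonMeasure r.ρ β : Measure (GaugeConfig 4 (2 * S + 1) (Matrix.specialUnitaryGroup (Fin 2) ℂ)))) atTop (𝓝 0)) →
    (∀ r : LatticeRep (Matrix.specialUnitaryGroup (Fin 2) ℂ), ∃ β₁ : ℝ, ∀ β : ℝ, β₁ ≤ β →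
      (∀ A B : YMSpecies (Matrix.specialUnitaryGroup (Fin 2) ℂ), ∃ χ : ℝ, ∀ S : ℕ,
        ∑ x ∈ Literature.Probability.LatticeModels.box 4 S,
        |covariance (fun U => A.F (Literature.MathematicalPhysics.QuantumLattice.torusLift (2 * S + 1) U))
          (fun U => B.F (Literature.MathematicalPhysics.QuantumLattice.configShift (-x)
          (Literature.MathematicalPhysics.QuantumLattice.torusLift (2 * S + 1) U)))
          (wilsonMeasure r.ρ β : Measure (GaugeConfig 4 (2 * S + 1) (Matrix.specialUnitaryGroup (Fin 2) ℂ)))| ≤ χ) →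
      ∃ C : ℝ, ∀ S : ℕ, ∀ F : GaugeConfig 4 (2 * S + 1) (Matrix.specialUnitaryGroup (Fin 2) ℂ) → ℝ, Measurable F →
        (∃ M : ℝ, ∀ U, |F U| ≤ M) →
        variance F (wilsonMeasure r.ρ β : Measure (GaugeConfig 4 (2 * S + 1) (Matrix.specialUnitaryGroup (Fin 2) ℂ))) ≤
          C * ∑ ℓ : Edge 4 (2 * S + 1), ∫ U, ∫ g, (F U - F (Function.update U ℓ g)) ^ 2
            ∂((haarProbability (Matrix.specialUnitaryGroup (Fin 2) ℂ)).tilted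
                (fun g' => -β * wilsonAction r.ρ (Function.update U ℓ g')))
            ∂(wilsonMeasure r.ρ β : Measure (GaugeConfig 4 (2 * S + 1) (Matrix.specialUnitaryGroup (Fin 2) ℂ)))) →
    ¬ (
      ∀ (G : Type) [Group G] [TopologicalSpace G] [IsTopologicalGroup G] [CompactSpace G]
        [MeasurableSpace G] [BorelSpace G], IsCompactSimpleLieGroup G → ∀ (r : LatticeRep G),
        (SimplyConnectedSpace G → ∃ β₁ : ℝ, ∀ β : ℝ, β₁ ≤ β →
        (∀ A B : YMSpecies G, ∃ χ : ℝ, ∀ S : ℕ, ∑ x ∈ Literature.Probability.LatticeModels.box 4 S,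
          |covariance (fun U => A.F (Literature.MathematicalPhysics.QuantumLattice.torusLift (2 * S + 1) U))
            (fun U => B.F (Literature.MathematicalPhysics.QuantumLattice.configShift (-x)
            (Literature.MathematicalPhysics.QuantumLattice.torusLift (2 * S + 1) U)))
            (wilsonMeasure r.ρ β : Measure (GaugeConfig 4 (2 * S + 1) G))| ≤ χ) →
        (∃ C : ℝ, ∀ S : ℕ, ∀ F : GaugeConfig 4 (2 * S + 1) G → ℝ, Measurable F → (∃ M : ℝ, ∀ U, |F U| ≤ M) →
          variance F (wilsonMeasure r.ρ β : Measure (GaugeConfig 4 (2 * S + 1) G)) ≤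
            C * ∑ ℓ : Edge 4 (2 * S + 1), ∫ U, ∫ g, (F U - F (Function.update U ℓ g)) ^ 2
              ∂((haarProbability G).tilted (fun g' => -β * wilsonAction r.ρ (Function.update U ℓ g')))
              ∂(wilsonMeasure r.ρ β : Measure (GaugeConfig 4 (2 * S + 1) G)))) →
        ∀ β : ℝ, 0 ≤ β →
        (∀ A B : YMSpecies G, ∃ χ : ℝ, ∀ S : ℕ, ∑ x ∈ Literature.Probability.LatticeModels.box 4 S,
          |covariance (fun U => A.F (Literature.MathematicalPhysics.QuantumLattice.torusLift (2 * S + 1) U))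
            (fun U => B.F (Literature.MathematicalPhysics.QuantumLattice.configShift (-x)
            (Literature.MathematicalPhysics.QuantumLattice.torusLift (2 * S + 1) U)))
            (wilsonMeasure r.ρ β : Measure (GaugeConfig 4 (2 * S + 1) G))| ≤ χ) →
        (∃ C : ℝ, ∀ S : ℕ, ∀ F : GaugeConfig 4 (2 * S + 1) G → ℝ, Measurable F → (∃ M : ℝ, ∀ U, |F U| ≤ M) →
          variance F (wilsonMeasure r.ρ β : Measure (GaugeConfig 4 (2 * S + 1) G)) ≤
            C * ∑ ℓ : Edge 4 (2 * S + 1), ∫ U, ∫ g, (F U - F (Function.update U ℓ g)) ^ 2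
              ∂((haarProbability G).tilted (fun g' => -β * wilsonAction r.ρ (Function.update U ℓ g')))
              ∂(wilsonMeasure r.ρ β : Measure (GaugeConfig 4 (2 * S + 1) G)))) := by
  intro hW hcore hT
  obtain ⟨r, β, hβ, hFS, δ, hδ, A, hmeas, hinv, hmass, hflux⟩ := hW
  obtain ⟨C, hC⟩ := hT (Matrix.specialUnitaryGroup (Fin 2) ℂ) isCompactSimpleLieGroup_su2 r (fun _ => hcore r) β hβ hFS
  exact not_invariantHeatBathPoincare_of_invariantBottleneck r β hδ A hmeas hinv hmass hflux
    ⟨C, fun S F hF hM _ => hC S F hF hM⟩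

end Summit.QuantumFields.YangMills.Theorems.SusceptibilityToPoincare.Negative

end
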